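import Mathlib.LinearAlgebra.Matrix.Charpoly.Coeff
import Mathlib.LinearAlgebra.Matrix.NonsingularInverse
import Mathlib.Algebra.Polynomial.Derivative
import Mathlib.Algebra.GCDMonoid.Finset
import Mathlib.Algebra.GCDMonoid.Nat
import Mathlib.Data.Matrix.Block
import HarnessLib

/-!
# «If `C` is not semisimple then `M_{n×n}(ℤ) ∩ [C]_ℂ` splits into infinitely many `GL_n(ℤ)`-conjugacy classes»
# (Hertling–Larabi 2026b Theorem 6.4 (c)) — the two-storey Jordan type, any rank: the family `(A m; 0 A)`

[topic LinearAlgebra/Matrix] Lane `lit-hodgefound` (Track 2 foundations library), seat p19 generation 40, row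
g40-#10.  General-rank companion of `RegularNilpotentIntegerMatrix.infinite_quot_conj` (g40-#8: a single nilpotent
Jordan block).  THEOREMS ONLY: no definition, no instance, no notation, no named fact (D-0026, net Literature
debt `0`), no `sorry`.

## Source, VERBATIM

C. Hertling, K. Larabi, *Conjugacy classes of regular integer matrices*, arXiv:2602.15748 (2026)
[HertlingLarabi2026b], held `paper:arxiv-2602.15748`, §6, chunk p0013: «**Theorem 6.4.** Fix a matrix
`C ∈ M_{n×n}(ℂ)` in Jordan normal form whose characteristic polynomial `f` is in `ℤ[t]`. Denote by `[C]_ℂ` its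
`GL_n(ℂ)`-conjugacy class. (a) `M_{n×n}(ℚ) ∩ [C]_ℂ` is a single `GL_n(ℚ)`-conjugacy class. […] (b) If `C` is
semisimple then `M_{n×n}(ℤ) ∩ [C]_ℂ` splits into finitely many `GL_n(ℤ)`-conjugacy classes. (c) If `C` is not
semisimple then `M_{n×n}(ℤ) ∩ [C]_ℂ` splits into infinitely many `GL_n(ℤ)`-conjugacy classes.»  §1, chunk p0003:
«The set `S_{1,f}` of `GL_n(ℤ)`-conjugacy classes of regular matrices in `M_{n×n}(ℤ)` with a fixed not semisimple
Jordan normal form […] is infinite, but a single additional invariant splits it into infinitely many finite sets.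
This invariant is the order of a full lattice which is associated to a given `GL_n(ℤ)`-conjugacy class.»  (The
statement is quoted from [HL26] = arXiv:2602.14973 there; no proof is printed in this paper.)

## What is proved (`A ∈ M_ι(ℤ)`, `q ∈ ℤ[t]` with `q(A) = 0 ≠ q′(A)`; `B_m = (A m·1; 0 A) ∈ M_{ι⊔ι}(ℤ)`)

The case of Theorem 6.4 (c) in which the Jordan normal form `C` is that of `B₁ = (A 1; 0 A)` — e.g. `A` the
companion matrix of a square-free `q`, `C = ⊕_{q(α)=0} J₂(α)` — with an explicit infinite family and an explicit
separating invariant (the matrix form of «the order»: the content of `q(N)`):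
* §1 `conj_aeval` (`PN = N′P ⟹ P·p(N) = p(N′)·P`), **`aeval_fromBlocks_dual`** (first-order Taylor expansion /
  dual numbers: `p(B_m) = (p(A) m·p′(A); 0 p(A))`), `aeval_fromBlocks_of_aeval_eq_zero` (`q(B_m) = m·(0 q′(A); 0 0)`).
* §2 `gcd_entries_eq_of_conj`: the content (gcd of the entries) of `M` is invariant under `M ↦ PMP⁻¹`,
  `P ∈ GL(ℤ)`; hence **`fromBlocks_conj_imp_eq`**: `B_m ∼ B_{m′}` over `GL(ℤ)` (`m, m′ ∈ ℕ`) forces `m = m′`.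
* §3 `equivalence_conj`; `rat_conj_fromBlocks`; **`infinite_quot_conj`**: the integer matrices `GL(ℚ)`-conjugate
  to `B₁` (this is `M(ℤ) ∩ [C]_ℂ` by Thm. 6.4 (a)) fall into infinitely many `GL(ℤ)`-classes — all `B_m`, `m ≥ 1`,
  lie there (`D = (1 0; 0 m)` conjugates over `ℚ`) and are pairwise non-conjugate over `ℤ`;
  `infinite_quot_conj_charpoly` (the case `q = χ_A`, Cayley–Hamilton, hypothesis `χ_A′(A) ≠ 0`).
* §4 (row g40-#12) the same with an extra summand `D`, `q(D) = 0` (block diagonal `(A m; 0 A) ⊕ D` over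
  `(ι ⊔ ι) ⊔ κ`): `aeval_fromBlocks_diag`, `aeval_sum_of_aeval_eq_zero`, `sum_conj_imp_eq`, `rat_conj_sum`,
  **`infinite_quot_conj_sum`** — Theorem 6.4 (c) for every Jordan type whose non-semisimple part has height `2`
  over one square-free factor `q` (`C = (two-storey blocks over the roots of q) ⊕ (q-semisimple part)`).
NOT here: an arbitrary non-semisimple Jordan type -- TODO(general form): blocks of height `≥ 3` mixed with
others (height exactly `n`: `RegularNilpotentIntegerMatrix.infinite_quot_conj`).
-/

open Matrix Polynomial

namespace Literature.LinearAlgebra.Matrix.NonSemisimpleIntegerMatrixClasses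

variable {ι : Type*} [Fintype ι] [DecidableEq ι]

/-! ## §1 Polynomials of `(A m; 0 A)`: the dual-number formula -/

/-- Intertwining passes to powers. [folklore] -/
private theorem conj_pow {N N' P : Matrix ι ι ℤ} (h : P * N = N' * P) (k : ℕ) : P * N ^ k = N' ^ k * P := by
  induction k with
  | zero => rw [pow_zero, pow_zero, mul_one, one_mul]
  | succ k ih => rw [pow_succ, ← mul_assoc, ih, mul_assoc, h, ← mul_assoc, ← pow_succ]

/-- **Intertwining passes to polynomials**: `PN = N′P ⟹ P·p(N) = p(N′)·P` — conjugation is an isomorphism of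
`ℤ[t]`-modules `(ℤⁿ, N) ≅ (ℤⁿ, N′)`. [cite: HertlingLarabi2026b, §6 Thm. 6.3 (its proof: `[t]·𝓑 = 𝓑·M`, change of basis), chunk p0012] -/
theorem conj_aeval {N N' P : Matrix ι ι ℤ} (h : P * N = N' * P) (p : ℤ[X]) :
    P * aeval N p = aeval N' p * P := by
  induction p using Polynomial.induction_on' with
  | add p q hp hq => rw [map_add, map_add, mul_add, add_mul, hp, hq]
  | monomial k c =>
    rw [← C_mul_X_pow_eq_monomial, map_mul, map_pow, aeval_C, aeval_X, map_mul, map_pow, aeval_C, aeval_X,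
      Algebra.algebraMap_eq_smul_one, smul_mul_assoc, smul_mul_assoc, one_mul, one_mul, Matrix.mul_smul,
      Matrix.smul_mul, conj_pow h]

/-- **The dual-number (first-order Taylor) formula**: for every `p ∈ ℤ[t]`,
`p((A m·1; 0 A)) = (p(A) m·p′(A); 0 p(A))`. [cite: HertlingLarabi2026b, §6 Thm. 6.4 (c) (the mechanism behind «infinitely many»: a nilpotent coupling of two copies of `A`), chunk p0013] -/
theorem aeval_fromBlocks_dual (A : Matrix ι ι ℤ) (m : ℤ) (p : ℤ[X]) :
    aeval (fromBlocks A (m • (1 : Matrix ι ι ℤ)) 0 A) p =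
      fromBlocks (aeval A p) (m • aeval A (derivative p)) 0 (aeval A p) := by
  induction p using Polynomial.induction_on with
  | C a =>
    rw [aeval_C, aeval_C, derivative_C, map_zero, smul_zero, Algebra.algebraMap_eq_smul_one,
      Algebra.algebraMap_eq_smul_one, ← fromBlocks_one, fromBlocks_smul]
    simp only [smul_zero]
  | add p q hp hq =>
    rw [map_add, hp, hq, map_add, derivative_add, map_add, smul_add, fromBlocks_add, add_zero]
  | monomial n a ih =>
    have e1 : C a * X ^ (n + 1) = C a * X ^ n * X := by rw [pow_succ, mul_assoc]
    have r1 : aeval A (C a * X ^ n * X) = aeval A (C a * X ^ n) * A := by rw [map_mul, aeval_X]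
    have r2 : aeval A (derivative (C a * X ^ n * X)) =
        aeval A (derivative (C a * X ^ n)) * A + aeval A (C a * X ^ n) := by
      rw [derivative_mul, derivative_X, mul_one, map_add, map_mul, aeval_X]
    rw [e1, map_mul (aeval (fromBlocks A (m • (1 : Matrix ι ι ℤ)) 0 A)), ih, aeval_X, fromBlocks_multiply, r1, r2]
    congr 1
    · rw [Matrix.mul_zero, add_zero]
    · rw [Matrix.mul_smul, Matrix.mul_one, Matrix.smul_mul, smul_add, add_comm]
    · rw [Matrix.zero_mul, Matrix.mul_zero, add_zero]
    · rw [Matrix.zero_mul, zero_add]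

/-- If `q(A) = 0` then `q((A m·1; 0 A)) = m·(0 q′(A); 0 0)`. [cite: HertlingLarabi2026b, §6 Thm. 6.4 (c), chunk p0013] -/
theorem aeval_fromBlocks_of_aeval_eq_zero {A : Matrix ι ι ℤ} {q : ℤ[X]} (hq : aeval A q = 0) (m : ℤ) :
    aeval (fromBlocks A (m • (1 : Matrix ι ι ℤ)) 0 A) q =
      m • fromBlocks (0 : Matrix ι ι ℤ) (aeval A (derivative q)) 0 0 := by
  rw [aeval_fromBlocks_dual, hq, fromBlocks_smul, smul_zero]

/-! ## §2 The content of `q(N)` is a class invariant -/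

/-- Divisibility of all entries is transported along `PM = M′P`, `P ∈ GL(ℤ)`. [folklore] -/
private theorem dvd_of_conj {κ : Type*} [Fintype κ] [DecidableEq κ] {M M' P : Matrix κ κ ℤ}
    (hP : IsUnit P.det) (h : P * M = M' * P) {d : ℤ} (hd : ∀ i j, d ∣ M i j) (i j : κ) : d ∣ M' i j := by
  obtain ⟨M₁, rfl⟩ : ∃ M₁ : Matrix κ κ ℤ, M = d • M₁ :=
    ⟨Matrix.of fun i j => M i j / d, by
      ext i j; rw [Matrix.smul_apply, Matrix.of_apply, smul_eq_mul, Int.mul_ediv_cancel' (hd i j)]⟩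
  have e : M' = d • (P * M₁ * P⁻¹) := by
    calc M' = M' * P * P⁻¹ := by rw [Matrix.mul_nonsing_inv_cancel_right P _ hP]
      _ = P * (d • M₁) * P⁻¹ := by rw [← h]
      _ = d • (P * M₁ * P⁻¹) := by rw [Matrix.mul_smul, Matrix.smul_mul]
  rw [e, Matrix.smul_apply, smul_eq_mul]
  exact Dvd.intro _ rfl

/-- **The content `gcd_{i,j} M_{ij}` is invariant under `M ↦ PMP⁻¹`, `P ∈ GL(ℤ)`** (applied to `M = q(N)`: the
matrix form of «the order of a full lattice which is associated to a given `GL_n(ℤ)`-conjugacy class» — whether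
`q([t])/d` lies in it). [cite: HertlingLarabi2026b, §1, chunk p0003] -/
theorem gcd_entries_eq_of_conj {κ : Type*} [Fintype κ] [DecidableEq κ] {M M' P : Matrix κ κ ℤ}
    (hP : IsUnit P.det) (h : P * M = M' * P) :
    (Finset.univ.gcd fun ij : κ × κ => M ij.1 ij.2) = Finset.univ.gcd fun ij : κ × κ => M' ij.1 ij.2 := by
  have h' : P⁻¹ * M' = M * P⁻¹ := by
    calc P⁻¹ * M' = P⁻¹ * M' * (P * P⁻¹) := by rw [Matrix.mul_nonsing_inv P hP, mul_one]
      _ = P⁻¹ * (M' * P) * P⁻¹ := by simp only [mul_assoc]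
      _ = P⁻¹ * (P * M) * P⁻¹ := by rw [h]
      _ = M * P⁻¹ := by rw [← mul_assoc, Matrix.nonsing_inv_mul P hP, one_mul]
  refine Int.dvd_antisymm (Int.nonneg_of_normalize_eq_self Finset.normalize_gcd)
    (Int.nonneg_of_normalize_eq_self Finset.normalize_gcd) ?_ ?_
  · exact Finset.dvd_gcd_iff.2 fun ij _ =>
      dvd_of_conj hP h (fun i j => Finset.gcd_dvd (Finset.mem_univ (i, j))) ij.1 ij.2
  · exact Finset.dvd_gcd_iff.2 fun ij _ =>
      dvd_of_conj (Matrix.isUnit_nonsing_inv_det P hP) h' (fun i j => Finset.gcd_dvd (Finset.mem_univ (i, j)))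
        ij.1 ij.2

/-- **`B_m ∼ B_{m′}` over `GL(ℤ)` forces `m = m′`** (`m, m′ ∈ ℕ`), when `q(A) = 0 ≠ q′(A)`: the content of
`q(B_m) = m·(0 q′(A); 0 0)` is `m` times the (nonzero) content of `q′(A)`.
[cite: HertlingLarabi2026b, §6 Thm. 6.4 (c), chunk p0013; §1 («a single additional invariant»), chunk p0003] -/
theorem fromBlocks_conj_imp_eq {A : Matrix ι ι ℤ} {q : ℤ[X]} (hq : aeval A q = 0)
    (hq' : aeval A (derivative q) ≠ 0) {m m' : ℕ}
    (h : ∃ P : Matrix (ι ⊕ ι) (ι ⊕ ι) ℤ, IsUnit P.det ∧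
      P * fromBlocks A ((m : ℤ) • (1 : Matrix ι ι ℤ)) 0 A = fromBlocks A ((m' : ℤ) • (1 : Matrix ι ι ℤ)) 0 A * P) :
    m = m' := by
  classical
  obtain ⟨P, hP, hPB⟩ := h
  have e := gcd_entries_eq_of_conj hP (conj_aeval hPB q)
  rw [aeval_fromBlocks_of_aeval_eq_zero hq, aeval_fromBlocks_of_aeval_eq_zero hq] at e
  simp only [Matrix.smul_apply, smul_eq_mul] at e
  rw [Finset.gcd_mul_left, Finset.gcd_mul_left, Int.normalize_coe_nat, Int.normalize_coe_nat] at e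
  -- the content of `(0 q′(A); 0 0)` is nonzero
  have hZ : (Finset.univ.gcd fun ij : (ι ⊕ ι) × (ι ⊕ ι) =>
      fromBlocks (0 : Matrix ι ι ℤ) (aeval A (derivative q)) 0 0 ij.1 ij.2) ≠ 0 := by
    intro h0
    apply hq'
    ext i j
    have := Finset.gcd_eq_zero_iff.1 h0 (Sum.inl i, Sum.inr j) (Finset.mem_univ _)
    rwa [fromBlocks_apply₁₂] at this
  exact_mod_cast mul_right_cancel₀ hZ e

/-! ## §3 Infinitely many `GL(ℤ)`-classes inside one `GL(ℚ)`-class -/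

/-- `GL(ℤ)`-conjugacy is an equivalence relation on any set of integer matrices. [cite: HertlingLarabi2026b, §6 Thm. 6.3 («`GL_n(ℤ)`-conjugacy classes»), chunk p0012] -/
theorem equivalence_conj {κ : Type*} [Fintype κ] [DecidableEq κ] (S : Matrix κ κ ℤ → Prop) :
    Equivalence fun N N' : {N : Matrix κ κ ℤ // S N} =>
      ∃ P : Matrix κ κ ℤ, IsUnit P.det ∧ P * N.1 = N'.1 * P where
  refl N := ⟨1, by rw [det_one]; exact isUnit_one, by rw [one_mul, mul_one]⟩
  symm := by
    rintro N N' ⟨P, hP, hPN⟩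
    refine ⟨P⁻¹, Matrix.isUnit_nonsing_inv_det P hP, ?_⟩
    calc P⁻¹ * N'.1 = P⁻¹ * N'.1 * (P * P⁻¹) := by rw [Matrix.mul_nonsing_inv P hP, mul_one]
      _ = P⁻¹ * (N'.1 * P) * P⁻¹ := by simp only [mul_assoc]
      _ = P⁻¹ * (P * N.1) * P⁻¹ := by rw [hPN]
      _ = N.1 * P⁻¹ := by rw [← mul_assoc, Matrix.nonsing_inv_mul P hP, one_mul]
  trans := by
    rintro N N' N'' ⟨P, hP, hPN⟩ ⟨P', hP', hP'N⟩
    refine ⟨P' * P, by rw [det_mul]; exact hP'.mul hP, ?_⟩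
    rw [mul_assoc, hPN, ← mul_assoc, hP'N, mul_assoc]

/-- `B_m` is `GL(ℚ)`-conjugate to `B₁` for `m ≠ 0`: `D·B_m = B₁·D` with `D = (1 0; 0 m·1)`.
[cite: HertlingLarabi2026b, §6 Thm. 6.4 (a) («a single `GL_n(ℚ)`-conjugacy class»), chunk p0013] -/
theorem rat_conj_fromBlocks (A : Matrix ι ι ℤ) (m : ℤ) (hm : m ≠ 0) :
    ∃ D : Matrix (ι ⊕ ι) (ι ⊕ ι) ℚ, IsUnit D.det ∧
      D * (fromBlocks A (m • (1 : Matrix ι ι ℤ)) 0 A).map (Int.castRingHom ℚ) =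
        (fromBlocks A (1 : Matrix ι ι ℤ) 0 A).map (Int.castRingHom ℚ) * D := by
  have hmap : ∀ c : ℤ, (c • (1 : Matrix ι ι ℤ)).map (Int.castRingHom ℚ) = (c : ℚ) • (1 : Matrix ι ι ℚ) := by
    intro c; ext i j
    simp only [Matrix.map_apply, Matrix.smul_apply, Matrix.one_apply, smul_eq_mul, mul_ite, mul_one, mul_zero,
      eq_intCast]
    split_ifs <;> simp
  refine ⟨fromBlocks 1 0 0 ((m : ℚ) • 1), ?_, ?_⟩
  · rw [det_fromBlocks_zero₂₁, det_one, one_mul, det_smul, det_one, mul_one]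
    exact (pow_ne_zero _ (by exact_mod_cast hm)).isUnit
  · have h0 : (0 : Matrix ι ι ℤ).map (Int.castRingHom ℚ) = 0 := Matrix.map_zero _ (map_zero _)
    have h1 : (1 : Matrix ι ι ℤ).map (Int.castRingHom ℚ) = 1 := by
      rw [← one_smul ℤ (1 : Matrix ι ι ℤ), hmap]; simp
    rw [fromBlocks_map, fromBlocks_map, hmap, h0, h1, fromBlocks_multiply, fromBlocks_multiply]
    simp only [Matrix.one_mul, Matrix.mul_one, Matrix.zero_mul, Matrix.mul_zero, add_zero, zero_add,
      Matrix.smul_mul, Matrix.mul_smul, Matrix.one_mul, Matrix.mul_one, smul_zero]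

/-- **Theorem 6.4 (c) for the two-storey Jordan type `(A 1; 0 A)`.**  If `q(A) = 0 ≠ q′(A)` (e.g. `A` the companion
matrix of a square-free `q`), the integer matrices that are `GL(ℚ)`-conjugate to `B₁ = (A 1; 0 A)` — i.e.
`M(ℤ) ∩ [B₁]_ℂ` by Thm. 6.4 (a) — split into INFINITELY many `GL(ℤ)`-conjugacy classes: the matrices
`B_m = (A m; 0 A)`, `m ≥ 1`, are pairwise non-conjugate over `ℤ` (content of `q(B_m)` is `m·content(q′(A))`).
[cite: HertlingLarabi2026b, §6 Thm. 6.4 (c), chunk p0013; §1, chunk p0003] -/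
theorem infinite_quot_conj {A : Matrix ι ι ℤ} {q : ℤ[X]} (hq : aeval A q = 0) (hq' : aeval A (derivative q) ≠ 0) :
    Infinite (Quot fun N N' : {N : Matrix (ι ⊕ ι) (ι ⊕ ι) ℤ //
        ∃ D : Matrix (ι ⊕ ι) (ι ⊕ ι) ℚ, IsUnit D.det ∧
          D * N.map (Int.castRingHom ℚ) = (fromBlocks A (1 : Matrix ι ι ℤ) 0 A).map (Int.castRingHom ℚ) * D} =>
      ∃ P : Matrix (ι ⊕ ι) (ι ⊕ ι) ℤ, IsUnit P.det ∧ P * N.1 = N'.1 * P) := by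
  classical
  let F : ℕ → Quot fun N N' : {N : Matrix (ι ⊕ ι) (ι ⊕ ι) ℤ //
        ∃ D : Matrix (ι ⊕ ι) (ι ⊕ ι) ℚ, IsUnit D.det ∧
          D * N.map (Int.castRingHom ℚ) = (fromBlocks A (1 : Matrix ι ι ℤ) 0 A).map (Int.castRingHom ℚ) * D} =>
      ∃ P : Matrix (ι ⊕ ι) (ι ⊕ ι) ℤ, IsUnit P.det ∧ P * N.1 = N'.1 * P :=
    fun m => Quot.mk _ ⟨fromBlocks A (((m + 1 : ℕ) : ℤ) • (1 : Matrix ι ι ℤ)) 0 A,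
      rat_conj_fromBlocks A _ (by exact_mod_cast Nat.succ_ne_zero m)⟩
  refine Infinite.of_injective F fun m m' hmm' => ?_
  have hrel := (Equivalence.eqvGen_iff (equivalence_conj _)).1 (Quot.eqvGen_exact hmm')
  have e : m + 1 = m' + 1 := fromBlocks_conj_imp_eq hq hq' hrel
  omega

/-- **Corollary (Cayley–Hamilton).**  For ANY integer matrix `A` with `χ_A′(A) ≠ 0` (e.g. `χ_A` separable), the
integer matrices `GL(ℚ)`-conjugate to `(A 1; 0 A)` split into infinitely many `GL(ℤ)`-classes.
[cite: HertlingLarabi2026b, §6 Thm. 6.4 (c), chunk p0013] -/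
theorem infinite_quot_conj_charpoly {A : Matrix ι ι ℤ} (h : aeval A (derivative A.charpoly) ≠ 0) :
    Infinite (Quot fun N N' : {N : Matrix (ι ⊕ ι) (ι ⊕ ι) ℤ //
        ∃ D : Matrix (ι ⊕ ι) (ι ⊕ ι) ℚ, IsUnit D.det ∧
          D * N.map (Int.castRingHom ℚ) = (fromBlocks A (1 : Matrix ι ι ℤ) 0 A).map (Int.castRingHom ℚ) * D} =>
      ∃ P : Matrix (ι ⊕ ι) (ι ⊕ ι) ℤ, IsUnit P.det ∧ P * N.1 = N'.1 * P) :=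
  infinite_quot_conj (Matrix.aeval_self_charpoly A) h

/-! ## §4 Adding a semisimple summand: the Jordan types `(A 1; 0 A) ⊕ D` with `q(D) = 0` (row g40-#12) -/

section WithSummand

variable {κ : Type*} [Fintype κ] [DecidableEq κ]

/-- Polynomials of a block diagonal matrix: `p(X ⊕ D) = p(X) ⊕ p(D)`. [cite: HertlingLarabi2026b, §6 Thm. 6.4 (a) («block diagonal matrices»), chunk p0013] -/
theorem aeval_fromBlocks_diag {ι' : Type*} [Fintype ι'] [DecidableEq ι'] (X : Matrix ι' ι' ℤ) (D : Matrix κ κ ℤ)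
    (p : ℤ[X]) : aeval (fromBlocks X 0 0 D) p = fromBlocks (aeval X p) 0 0 (aeval D p) := by
  induction p using Polynomial.induction_on with
  | C a =>
    rw [aeval_C, aeval_C, aeval_C, Algebra.algebraMap_eq_smul_one, Algebra.algebraMap_eq_smul_one,
      Algebra.algebraMap_eq_smul_one, ← fromBlocks_one, fromBlocks_smul]
    simp only [smul_zero]
  | add p q hp hq => rw [map_add, hp, hq, map_add, map_add, fromBlocks_add, add_zero, add_zero]
  | monomial n a ih =>
    have e1 : C a * Polynomial.X ^ (n + 1) = C a * Polynomial.X ^ n * Polynomial.X := by rw [pow_succ, mul_assoc]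
    have rX : aeval X (C a * Polynomial.X ^ n * Polynomial.X) = aeval X (C a * Polynomial.X ^ n) * X := by
      rw [map_mul, aeval_X]
    have rD : aeval D (C a * Polynomial.X ^ n * Polynomial.X) = aeval D (C a * Polynomial.X ^ n) * D := by
      rw [map_mul, aeval_X]
    rw [e1, map_mul (aeval (fromBlocks X 0 0 D)), ih, aeval_X, fromBlocks_multiply, rX, rD]
    congr 1
    · rw [Matrix.zero_mul, add_zero]
    · rw [Matrix.mul_zero, Matrix.zero_mul, add_zero]
    · rw [Matrix.zero_mul, Matrix.mul_zero, add_zero]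
    · rw [Matrix.zero_mul, zero_add]

/-- `q((A m; 0 A) ⊕ D) = m·((0 q′(A); 0 0) ⊕ 0)` when `q(A) = 0 = q(D)`. [cite: HertlingLarabi2026b, §6 Thm. 6.4 (c), chunk p0013] -/
theorem aeval_sum_of_aeval_eq_zero {A : Matrix ι ι ℤ} {D : Matrix κ κ ℤ} {q : ℤ[X]} (hq : aeval A q = 0)
    (hD : aeval D q = 0) (m : ℤ) :
    aeval (fromBlocks (fromBlocks A (m • (1 : Matrix ι ι ℤ)) 0 A) 0 0 D) q =
      m • fromBlocks (fromBlocks (0 : Matrix ι ι ℤ) (aeval A (derivative q)) 0 0) 0 0 (0 : Matrix κ κ ℤ) := by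
  rw [aeval_fromBlocks_diag, aeval_fromBlocks_of_aeval_eq_zero hq, hD]
  simp only [fromBlocks_smul, smul_zero]

/-- **`(B_m ⊕ D) ∼ (B_{m′} ⊕ D)` over `GL(ℤ)` forces `m = m′`** (`m, m′ ∈ ℕ`), when `q(A) = 0 = q(D)`, `q′(A) ≠ 0`.
[cite: HertlingLarabi2026b, §6 Thm. 6.4 (c), chunk p0013; §1, chunk p0003] -/
theorem sum_conj_imp_eq {A : Matrix ι ι ℤ} {D : Matrix κ κ ℤ} {q : ℤ[X]} (hq : aeval A q = 0)
    (hD : aeval D q = 0) (hq' : aeval A (derivative q) ≠ 0) {m m' : ℕ}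
    (h : ∃ P : Matrix ((ι ⊕ ι) ⊕ κ) ((ι ⊕ ι) ⊕ κ) ℤ, IsUnit P.det ∧
      P * fromBlocks (fromBlocks A ((m : ℤ) • (1 : Matrix ι ι ℤ)) 0 A) 0 0 D =
        fromBlocks (fromBlocks A ((m' : ℤ) • (1 : Matrix ι ι ℤ)) 0 A) 0 0 D * P) :
    m = m' := by
  classical
  obtain ⟨P, hP, hPB⟩ := h
  have e := gcd_entries_eq_of_conj hP (conj_aeval hPB q)
  rw [aeval_sum_of_aeval_eq_zero hq hD, aeval_sum_of_aeval_eq_zero hq hD] at e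
  simp only [Matrix.smul_apply, smul_eq_mul] at e
  rw [Finset.gcd_mul_left, Finset.gcd_mul_left, Int.normalize_coe_nat, Int.normalize_coe_nat] at e
  have hZ : (Finset.univ.gcd fun ij : ((ι ⊕ ι) ⊕ κ) × ((ι ⊕ ι) ⊕ κ) =>
      fromBlocks (fromBlocks (0 : Matrix ι ι ℤ) (aeval A (derivative q)) 0 0) 0 0 (0 : Matrix κ κ ℤ)
        ij.1 ij.2) ≠ 0 := by
    intro h0
    apply hq'
    ext i j
    have := Finset.gcd_eq_zero_iff.1 h0 (Sum.inl (Sum.inl i), Sum.inl (Sum.inr j)) (Finset.mem_univ _)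
    rwa [fromBlocks_apply₁₁, fromBlocks_apply₁₂] at this
  exact_mod_cast mul_right_cancel₀ hZ e

/-- `B_m ⊕ D` is `GL(ℚ)`-conjugate to `B₁ ⊕ D` for `m ≠ 0`. [cite: HertlingLarabi2026b, §6 Thm. 6.4 (a), chunk p0013] -/
theorem rat_conj_sum (A : Matrix ι ι ℤ) (D : Matrix κ κ ℤ) (m : ℤ) (hm : m ≠ 0) :
    ∃ E : Matrix ((ι ⊕ ι) ⊕ κ) ((ι ⊕ ι) ⊕ κ) ℚ, IsUnit E.det ∧
      E * (fromBlocks (fromBlocks A (m • (1 : Matrix ι ι ℤ)) 0 A) 0 0 D).map (Int.castRingHom ℚ) =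
        (fromBlocks (fromBlocks A (1 : Matrix ι ι ℤ) 0 A) 0 0 D).map (Int.castRingHom ℚ) * E := by
  obtain ⟨D₀, hD₀, hD₀B⟩ := rat_conj_fromBlocks A m hm
  have h0a : (0 : Matrix (ι ⊕ ι) κ ℤ).map (Int.castRingHom ℚ) = 0 := Matrix.map_zero _ (map_zero _)
  have h0b : (0 : Matrix κ (ι ⊕ ι) ℤ).map (Int.castRingHom ℚ) = 0 := Matrix.map_zero _ (map_zero _)
  refine ⟨fromBlocks D₀ 0 0 1, ?_, ?_⟩
  · rw [det_fromBlocks_zero₂₁, det_one, mul_one]; exact hD₀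
  · rw [fromBlocks_map, fromBlocks_map (fromBlocks A 1 0 A), h0a, h0b, fromBlocks_multiply, fromBlocks_multiply,
      hD₀B]
    simp only [Matrix.mul_zero, Matrix.zero_mul, add_zero, zero_add, Matrix.one_mul, Matrix.mul_one]

/-- **Theorem 6.4 (c) for the Jordan types `(A 1; 0 A) ⊕ D`** with `q(A) = 0 = q(D)`, `q′(A) ≠ 0` (e.g.
`J₂(λ)^{⊕r} ⊕ S` with `S` semisimple, or two-storey blocks over a square-free `q` plus a `q`-semisimple part):
the integer matrices `GL(ℚ)`-conjugate to `B₁ ⊕ D` split into infinitely many `GL(ℤ)`-classes.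
[cite: HertlingLarabi2026b, §6 Thm. 6.4 (c), chunk p0013; §1, chunk p0003] -/
theorem infinite_quot_conj_sum {A : Matrix ι ι ℤ} {D : Matrix κ κ ℤ} {q : ℤ[X]} (hq : aeval A q = 0)
    (hD : aeval D q = 0) (hq' : aeval A (derivative q) ≠ 0) :
    Infinite (Quot fun N N' : {N : Matrix ((ι ⊕ ι) ⊕ κ) ((ι ⊕ ι) ⊕ κ) ℤ //
        ∃ E : Matrix ((ι ⊕ ι) ⊕ κ) ((ι ⊕ ι) ⊕ κ) ℚ, IsUnit E.det ∧
          E * N.map (Int.castRingHom ℚ) =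
            (fromBlocks (fromBlocks A (1 : Matrix ι ι ℤ) 0 A) 0 0 D).map (Int.castRingHom ℚ) * E} =>
      ∃ P : Matrix ((ι ⊕ ι) ⊕ κ) ((ι ⊕ ι) ⊕ κ) ℤ, IsUnit P.det ∧ P * N.1 = N'.1 * P) := by
  classical
  let F : ℕ → Quot fun N N' : {N : Matrix ((ι ⊕ ι) ⊕ κ) ((ι ⊕ ι) ⊕ κ) ℤ //
        ∃ E : Matrix ((ι ⊕ ι) ⊕ κ) ((ι ⊕ ι) ⊕ κ) ℚ, IsUnit E.det ∧
          E * N.map (Int.castRingHom ℚ) =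
            (fromBlocks (fromBlocks A (1 : Matrix ι ι ℤ) 0 A) 0 0 D).map (Int.castRingHom ℚ) * E} =>
      ∃ P : Matrix ((ι ⊕ ι) ⊕ κ) ((ι ⊕ ι) ⊕ κ) ℤ, IsUnit P.det ∧ P * N.1 = N'.1 * P :=
    fun m => Quot.mk _ ⟨fromBlocks (fromBlocks A (((m + 1 : ℕ) : ℤ) • (1 : Matrix ι ι ℤ)) 0 A) 0 0 D,
      rat_conj_sum A D _ (by exact_mod_cast Nat.succ_ne_zero m)⟩
  refine Infinite.of_injective F fun m m' hmm' => ?_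
  have hrel := (Equivalence.eqvGen_iff (equivalence_conj _)).1 (Quot.eqvGen_exact hmm')
  have e : m + 1 = m' + 1 := sum_conj_imp_eq hq hD hq' hrel
  omega

end WithSummand

end Literature.LinearAlgebra.Matrix.NonSemisimpleIntegerMatrixClasses
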